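import Literature.AlgebraicGeometry.Limits.ConstructibleEmptyGenericFibre
import Mathlib.AlgebraicGeometry.ResidueField
import Mathlib.FieldTheory.IsAlgClosed.AlgebraicClosure
import HarnessLib

/-!
# The COFINITE PASSAGE «generic injectivity + finite-type Isom-pieces ⇒ special injectivity at all but finitely many primes»

Topic `Literature/AlgebraicGeometry/Limits`; namespace `Literature.AlgebraicGeometry.Limits`.  THEOREMS ONLY (no definition, no named fact, no
instance, no notation, no `sorry`).  Cell `hodgecm-mathlib` (D-0151), P6 «MOD programme» (crux hLiu418 = stmt-HodgeConjecture-24832,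
`--supports`, count-neutral): the abstract core of the P-line socket `stub_INJ0` (desk memo `MEMO-PLINE-cut` v1 row G7-(L1′); LEAD F0P6-plan (g3)
deal 23:39:39Z (o1)), stated over the OUTPUT SHAPE of the SP3-a2 head `F0P6aIsomSchemeFiniteType.isomPieces_finiteType_of_line`
(«the geometric points `t` of the stage `W` at which a property `Φ` holds are exactly those lifting to one of finitely many quasi-compact
finite-type `W`-schemes `mᵢ : I i → W`») and feeding ★ SP3-b `finite_iUnion_range_of_bot_notMem`.  HC_CM is proved only modulo the printed
citations until rung 0 closes; this file is generic and changes no count.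

THE MATHEMATICS ([EGAIV3] (9.2.1)–(9.2.3), [StacksProject] 054J ∕ 00FE, [GortzWedhorn2020] Prop. 10.14, [MumfordFogartyKirwan1994] Ch. 7 §2 proof of
Thm. 7.9: «the `Isom`-scheme of two families is of finite type; if it has no point over the generic point it lies over a proper closed subset of
the Dedekind base, i.e. over finitely many primes»).  Let `B` be a Dedekind domain, `w : W → Spec B` quasi-compact and locally of finite type, and
`Φ` a property of geometric points `t : Spec Ω → W` (e.g. «the two pulled-back PEL tuples are isomorphic at `t`»).  Suppose (PIECES) `Φ t` holds iff
`t` lifts to one of finitely many quasi-compact, locally-finite-type `W`-schemes `I i`, and (GENERIC INJECTIVITY) `Φ` FAILS at every geometric point of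
`W` over the generic point of `Spec B`.  Then no piece has a point over the generic point (a point `x ∈ I i` over `⊥` carries the geometric point
`Spec κ(x)‾ → I i → W`, at which `Φ` holds), so by SP3-b the pieces lie over a FINITE set `Σ` of primes, and `Φ` FAILS at every geometric point of
`W` over a prime outside `Σ` (SPECIAL INJECTIVITY off `Σ`).

* §1 `exists_geometricPoint_of_mem` — through every point `x` of a scheme passes a geometric point `Spec κ(x)‾ → X`;
* §2 **`exists_finite_forall_mem_of_pieces`** — the passage: `∃ Σ finite, ∀ t, Φ t → (t ≫ w)(pt) ∈ Σ`; `exists_finite_forall_not_of_pieces` — the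
  reading «`Φ` fails over every prime outside `Σ`»; `exists_finset_heightOneSpectrum_forall_not_of_pieces` — the same with a `Finset` of nonzero primes
  (the consumer's `S_M : Finset (HeightOneSpectrum _)` currency).

## References
* [EGAIV3] A. Grothendieck, J. Dieudonné, *Éléments de géométrie algébrique IV₃*, Publ. Math. IHÉS 28 (1966), (9.2.1)–(9.2.3).
* [StacksProject] The Stacks Project, Tags 054J, 00FE.
* [GortzWedhorn2020] U. Görtz, T. Wedhorn, *Algebraic Geometry I* (2nd ed. 2020), Proposition 10.14, Section (10.7).
* [MumfordFogartyKirwan1994] D. Mumford, J. Fogarty, F. Kirwan, *Geometric Invariant Theory*, 3rd ed. (1994), Ch. 7 §2 Prop. 7.3, Thm. 7.9 (pp. 132–139).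
* [Neukirch1999] J. Neukirch, *Algebraic Number Theory* (1999), Ch. I (3.3).
-/

set_option autoImplicit false

noncomputable section

universe u

open CategoryTheory CategoryTheory.Limits AlgebraicGeometry TopologicalSpace PrimeSpectrum

namespace Literature.AlgebraicGeometry.Limits

/-! ## §1 Geometric points through a point -/

/-- **Through every point of a scheme passes a geometric point**: for `x ∈ X` the composite `Spec κ(x)‾ → Spec κ(x) → X` (an algebraic closure of
the residue field) is a geometric point centred at `x`. [cite: GortzWedhorn2020, Section (10.7)] -/
theorem exists_geometricPoint_of_mem {X : Scheme.{u}} (x : X) :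
    ∃ (Ω : Type u) (_ : Field Ω) (_ : IsAlgClosed Ω) (s : Spec (CommRingCat.of Ω) ⟶ X), s.base (IsLocalRing.closedPoint Ω) = x := by
  let Ω₀ : Type u := AlgebraicClosure (X.residueField x)
  refine ⟨Ω₀, inferInstance, inferInstance,
    Spec.map (CommRingCat.ofHom (algebraMap (X.residueField x) Ω₀)) ≫ X.fromSpecResidueField x, ?_⟩
  change (X.fromSpecResidueField x).base _ = x
  exact Scheme.fromSpecResidueField_apply x _

/-! ## §2 The passage -/

section Passage

variable {B : Type u} [CommRing B] [IsDedekindDomain B] {W : Scheme.{u}} (w : W ⟶ Spec (CommRingCat.of B))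
  [LocallyOfFiniteType w] [QuasiCompact w]
  (Φ : ∀ ⦃Ω : Type u⦄ [Field Ω] [IsAlgClosed Ω], (Spec (CommRingCat.of Ω) ⟶ W) → Prop)

/-- **THE COFINITE PASSAGE.**  Let `w : W → Spec B` (`B` Dedekind) be quasi-compact and locally of finite type, and `Φ` a property of geometric
points of `W` such that (PIECES) `Φ t ↔ t` lifts to one of finitely many quasi-compact finite-type `W`-schemes `mᵢ : I i → W` (the output of the
SP3-a2 head `isomPieces_finiteType_of_line`) and (GENERIC) `Φ` fails at every geometric point over the generic point `⊥ ∈ Spec B`.  Then there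
is a FINITE set `Σ` of primes of `B` such that every geometric point at which `Φ` holds lies over a prime of `Σ` — the pieces have empty generic
fibre (§1), so ★ SP3-b `finite_iUnion_range_of_bot_notMem` applies to `mᵢ ≫ w`.
[cite: EGAIV3, (9.2.1)–(9.2.3)] [cite: StacksProject, Tag 054J] [cite: MumfordFogartyKirwan1994, Ch. 7 §2 Proposition 7.3 (p. 132)] -/
theorem exists_finite_forall_mem_of_pieces
    (hpieces : ∃ (n : ℕ) (I : Fin n → Scheme.{u}) (m : ∀ i, I i ⟶ W) (_ : ∀ i, QuasiCompact (m i))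
      (_ : ∀ i, LocallyOfFiniteType (m i)),
      ∀ ⦃Ω : Type u⦄ [Field Ω] [IsAlgClosed Ω] (t : Spec (CommRingCat.of Ω) ⟶ W),
        Φ t ↔ ∃ (i : Fin n) (s : Spec (CommRingCat.of Ω) ⟶ I i), s ≫ m i = t)
    (hgen : ∀ ⦃Ω : Type u⦄ [Field Ω] [IsAlgClosed Ω] (t : Spec (CommRingCat.of Ω) ⟶ W),
      (t ≫ w).base (IsLocalRing.closedPoint Ω) = (⊥ : PrimeSpectrum B) → ¬ Φ t) :
    ∃ Sg : Set (PrimeSpectrum B), Sg.Finite ∧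
      ∀ ⦃Ω : Type u⦄ [Field Ω] [IsAlgClosed Ω] (t : Spec (CommRingCat.of Ω) ⟶ W),
        Φ t → (t ≫ w).base (IsLocalRing.closedPoint Ω) ∈ Sg := by
  obtain ⟨n, I, m, hqc, hlft, hI⟩ := hpieces
  haveI : ∀ i, QuasiCompact (m i ≫ w) := fun i => by haveI := hqc i; infer_instance
  haveI : ∀ i, LocallyOfFiniteType (m i ≫ w) := fun i => by haveI := hlft i; infer_instance
  -- no piece has a point over the generic point
  have h0 : ∀ i, (⊥ : PrimeSpectrum B) ∉ Set.range (m i ≫ w).base := by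
    rintro i ⟨x, hx⟩
    obtain ⟨Ω, _, _, s, hs⟩ := exists_geometricPoint_of_mem x
    have hΦ : Φ (s ≫ m i) := (hI (s ≫ m i)).2 ⟨i, s, rfl⟩
    refine hgen (s ≫ m i) ?_ hΦ
    rw [Category.assoc, Scheme.Hom.comp_apply, hs]
    exact hx
  refine ⟨⋃ i, Set.range (m i ≫ w).base, finite_iUnion_range_of_bot_notMem I (fun i => m i ≫ w) h0, fun Ω _ _ t ht => ?_⟩
  obtain ⟨i, s, rfl⟩ := (hI t).1 ht
  exact Set.mem_iUnion.2 ⟨i, s.base (IsLocalRing.closedPoint Ω), by simp only [Category.assoc, Scheme.Hom.comp_apply]⟩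

/-- **SPECIAL INJECTIVITY OFF `Σ`** (reading of `exists_finite_forall_mem_of_pieces`): `Φ` fails at every geometric point of `W` over a prime outside
the finite set `Σ`. [cite: MumfordFogartyKirwan1994, Ch. 7 §2 Proposition 7.3 (p. 132)] [cite: GortzWedhorn2020, Proposition 10.14] -/
theorem exists_finite_forall_not_of_pieces
    (hpieces : ∃ (n : ℕ) (I : Fin n → Scheme.{u}) (m : ∀ i, I i ⟶ W) (_ : ∀ i, QuasiCompact (m i))
      (_ : ∀ i, LocallyOfFiniteType (m i)),
      ∀ ⦃Ω : Type u⦄ [Field Ω] [IsAlgClosed Ω] (t : Spec (CommRingCat.of Ω) ⟶ W),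
        Φ t ↔ ∃ (i : Fin n) (s : Spec (CommRingCat.of Ω) ⟶ I i), s ≫ m i = t)
    (hgen : ∀ ⦃Ω : Type u⦄ [Field Ω] [IsAlgClosed Ω] (t : Spec (CommRingCat.of Ω) ⟶ W),
      (t ≫ w).base (IsLocalRing.closedPoint Ω) = (⊥ : PrimeSpectrum B) → ¬ Φ t) :
    ∃ Sg : Set (PrimeSpectrum B), Sg.Finite ∧
      ∀ ⦃Ω : Type u⦄ [Field Ω] [IsAlgClosed Ω] (t : Spec (CommRingCat.of Ω) ⟶ W),
        (t ≫ w).base (IsLocalRing.closedPoint Ω) ∉ Sg → ¬ Φ t := by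
  obtain ⟨Sg, hSg, h⟩ := exists_finite_forall_mem_of_pieces w Φ hpieces hgen
  exact ⟨Sg, hSg, fun Ω _ _ t ht hΦ => ht (h t hΦ)⟩

/-- **HEIGHT-ONE FINSET FORM** (the consumer's `S_M : Finset (HeightOneSpectrum B)` currency): there is a finite set `S` of nonzero primes such that
`Φ` fails at every geometric point of `W` lying over a nonzero prime `v ∉ S` (the generic point is excluded by (GENERIC) anyway).
[cite: MumfordFogartyKirwan1994, Ch. 7 §2 Proposition 7.3 (p. 132)] [cite: Neukirch1999, Ch. I (3.3)] -/
theorem exists_finset_heightOneSpectrum_forall_not_of_pieces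
    (hpieces : ∃ (n : ℕ) (I : Fin n → Scheme.{u}) (m : ∀ i, I i ⟶ W) (_ : ∀ i, QuasiCompact (m i))
      (_ : ∀ i, LocallyOfFiniteType (m i)),
      ∀ ⦃Ω : Type u⦄ [Field Ω] [IsAlgClosed Ω] (t : Spec (CommRingCat.of Ω) ⟶ W),
        Φ t ↔ ∃ (i : Fin n) (s : Spec (CommRingCat.of Ω) ⟶ I i), s ≫ m i = t)
    (hgen : ∀ ⦃Ω : Type u⦄ [Field Ω] [IsAlgClosed Ω] (t : Spec (CommRingCat.of Ω) ⟶ W),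
      (t ≫ w).base (IsLocalRing.closedPoint Ω) = (⊥ : PrimeSpectrum B) → ¬ Φ t) :
    ∃ S : Finset (IsDedekindDomain.HeightOneSpectrum B),
      ∀ (v : IsDedekindDomain.HeightOneSpectrum B), v ∉ S →
        ∀ ⦃Ω : Type u⦄ [Field Ω] [IsAlgClosed Ω] (t : Spec (CommRingCat.of Ω) ⟶ W),
          (t ≫ w).base (IsLocalRing.closedPoint Ω) = ⟨v.asIdeal, v.isPrime⟩ → ¬ Φ t := by
  classical
  obtain ⟨Sg, hSg, h⟩ := exists_finite_forall_not_of_pieces w Φ hpieces hgen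
  have hinj : Set.InjOn (fun v : IsDedekindDomain.HeightOneSpectrum B => (⟨v.asIdeal, v.isPrime⟩ : PrimeSpectrum B))
      ((fun v : IsDedekindDomain.HeightOneSpectrum B => (⟨v.asIdeal, v.isPrime⟩ : PrimeSpectrum B)) ⁻¹' Sg) :=
    fun v _ v' _ hvv' => IsDedekindDomain.HeightOneSpectrum.ext (by simpa using congrArg PrimeSpectrum.asIdeal hvv')
  refine ⟨(hSg.preimage hinj).toFinset, fun v hv Ω _ _ t ht => h t ?_⟩
  rw [ht]
  intro hmem
  exact hv ((hSg.preimage hinj).mem_toFinset.2 hmem)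

end Passage

end Literature.AlgebraicGeometry.Limits

end
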